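import Mathlib
import Summits.Ventures.FusionMHD.Models.SAlphaPolyWitnessS15A0975Panels0
import Summits.Ventures.FusionMHD.Models.SAlphaPolyWitnessS15A095
import Literature.MathematicalPhysics.MHD.BallooningSAlphaWitnessInterval
import HarnessLib

/-!
# F3 «F3.BALLOON-sα-S3o2-BAND-19/20-39/40»: at shear `s = 3/2` the SAME polynomial trial function as the `(3/2, 19/20)` witness (`SAlphaPolyWitnessS15A095.UX`) has kernel-certified NEGATIVE energy also at `α = 39/40`, so by convexity of the one-surface energy in `α` (gridfusion-lit-3's `BallooningSAlphaWitnessInterval`) EVERY surface `(3/2, α)` with `19/20 ≤ α ≤ 39/40` is on the UNSTABLE side — the certified unstable set at `s = 3/2` becomes ONE interval reaching the two-turn lens (★ #250)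

LADDER-GRIDFUSION rung F3 (cell `gridfusion`).  Assembly by gridfusion-model-7 g9, 2026-08-28, in model-7's poly-witness lane: (i) the program
`pw5bProg` (the `s–α` energy density at `(s, α) = (3/2, 39/40)`) applied to the trial polynomial `UX` / `UXd` of `SAlphaPolyWitnessS15A095Defs` (BY NAME via `export`;
no new trial function), (ii) ONE panel file `SAlphaPolyWitnessS15A0975Panels0` (10 kernel-decided Taylor-model integral enclosures on a graded grid of `[0, 8]`), and (iii)
here: the point theorem `unstableWitness_threeHalves_0975 : SAlpha.UnstableWitness (3 / 2) (39 / 40) (−8) 8 (Poly.eval UX) (Poly.eval UXd)` (`W ≤ -3/25`) and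
★★ `unstableWitness_threeHalves_Icc : ∀ α ∈ Icc (19/20) (39/40), SAlpha.UnstableWitness (3 / 2) α (−8) 8 (Poly.eval UX) (Poly.eval UXd)` from it and `SAlphaPolyWitnessS15A095.unstableWitness_threeHalves_095` by
lit-3's convexity-in-`α` lemma `SAlpha.unstableWitness_of_mem_Icc` (the energy of a FIXED trial function is a convex quadratic in `α`).  0 kit in the kernel
objects; no `native_decide`; `π` does not enter.

## THREE COLUMNS
CERTIFIED: in the `s–α` ballooning MODEL (Freidberg (12.96)–(12.99)) at shear `s = 3/2`: the explicit even polynomial `X = SAlphaPolyWitnessS15A095.UX` (degree 26,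
`X(±8) = 0`) has negative one-surface energy at `α = 19/20` (`SAlphaPolyWitnessS15A095.unstableWitness_threeHalves_095`) AND at `α = 39/40` (`W ≤ -3/25`, this file), hence at EVERY
`α ∈ [19/20, 39/40]`: the MODEL's unstable `α`-set at `s = 3/2` CONTAINS THE WHOLE INTERVAL `[19/20, 39/40]`; since `39/40 = lensLo 3/2` is the
lower vertex value of the two-turn lens (★ #250 `SAlphaTwoTurnLens.unstableWitness_of_mem_lens`, unstable up to `lensHi 3/2 = 137/50 (= 22/25 + 93/50)`), the certified
unstable set at this shear is the connected interval `[19/20, 137/50 (= 22/25 + 93/50)]` (two trial functions: `X` on `[19/20, 39/40]`, the two-turn bump on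
`[39/40, 137/50 (= 22/25 + 93/50)]`); connectedness of the model's full unstable set / monotonicity of the edge are NOT typed.  VALIDATED (not in the kernel): E–L shooting first edge at s = 3/2 ≈ 0.885 (lit-4 kit j299948); kernel enclosure of the half integral at 39/40: [−0.066033, −0.064051];
float energy of `X` at `(3/2, 39/40)` `≈ -0.1301`.  MODELLED: `s–α` model (large-aspect-ratio shifted circles, high-`n` ballooning
ordering, `θ₀ = 0`, ideal MHD); «unstable» = the MODEL's one-surface energy admits a negative compactly supported trial function (lit-3's witness class;
representation step `W̄ < 0 ⇒ δW < 0`, Connor–Hastie–Taylor 1979, quoted in the Literature file, NOT typed); no device, no `β`-limit.  Citations: Freidberg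
2014 §12.3 (12.38)–(12.40), §12.6.2 (12.97)–(12.100), Fig. 12.5 [Freidberg2014]; Mahboubi–Melquiond–Sibut-Pinote 2016 [MahboubiMelquiondSibutpinote2016];
Makino–Berz 2003 [MakinoBerz2003].  Everything below is [instance data].
-/

open MeasureTheory
open Literature.Analysis.ValidatedNumerics Literature.Analysis.ValidatedNumerics.PolyMP
open Literature.Analysis.ValidatedNumerics.NumericsMP Literature.Analysis.ValidatedNumerics.ExpPoly
open Literature.MathematicalPhysics.MHD.Ballooning
open Real Set

namespace Summit.Ventures.FusionMHD.Models

namespace SAlphaPolyWitnessS15A0975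

/-! ### §1 The trial function: derivative, zeros at `±8`, parity -/

/-- `Poly.deriv UX = UXd`. [instance data] -/
private theorem deriv_UX : Poly.deriv UX = UXd := by
  decide +kernel

/-- `X(8) = 0` (exact). [instance data] -/
private theorem UX_at_L : Poly.eval UX (8 : ℝ) = 0 := by
  norm_num [UX, Poly.eval]

/-- `X(−8) = 0` (exact). [instance data] -/
private theorem UX_at_negL : Poly.eval UX (-8 : ℝ) = 0 := by
  norm_num [UX, Poly.eval]

/-- `X` is even. [instance data] -/
private theorem UX_even (θ : ℝ) : Poly.eval UX (-θ) = Poly.eval UX θ := by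
  simp only [UX, Poly.eval]
  push_cast
  ring

/-- `X′` is odd. [instance data] -/
private theorem UXd_odd (θ : ℝ) : Poly.eval UXd (-θ) = -Poly.eval UXd θ := by
  simp only [UXd, Poly.eval]
  push_cast
  ring

/-- `X′ = Poly.eval UXd` is the derivative of `X = Poly.eval UX` everywhere. [instance data] -/
private theorem hasDerivAt_UX (θ : ℝ) : HasDerivAt (Poly.eval UX) (Poly.eval UXd θ) θ := by
  have h := Poly.hasDerivAt_eval UX θ
  rwa [deriv_UX] at h

/-! ### §2 The energy density of `X`: parity, continuity, the certified half-window integral -/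

/-- The energy density of the even `X` is even in `θ`. [instance data] -/
private theorem density_even (θ : ℝ) : (SAlpha.energyDensity (3 / 2) (39 / 40) (Poly.eval UX) (Poly.eval UXd)) (-θ) = (SAlpha.energyDensity (3 / 2) (39 / 40) (Poly.eval UX) (Poly.eval UXd)) θ := by
  unfold SAlpha.energyDensity SAlpha.bending SAlpha.drive SAlpha.shearParam
  rw [UX_even, UXd_odd, Real.sin_neg, Real.cos_neg]
  ring

/-- The energy density of `X` is continuous. [instance data] -/
private theorem density_continuous : Continuous (SAlpha.energyDensity (3 / 2) (39 / 40) (Poly.eval UX) (Poly.eval UXd)) := by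
  have h1 : Continuous (Poly.eval UX) := Poly.continuous_eval UX
  have h2 : Continuous (Poly.eval UXd) := Poly.continuous_eval UXd
  unfold SAlpha.energyDensity SAlpha.bending SAlpha.drive SAlpha.shearParam
  fun_prop

/-- THE CERTIFIED HALF-WINDOW INTEGRAL: `∫₀^8 [(1+Λ²)X′² − α(Λ sin θ + cos θ)X²] dθ ≤ -3/50` (kernel enclosure of the 10 panels:
`[-0.066033, -0.064051]`; float value `-0.065058`). [instance data] -/
theorem half_integral_le : ∫ θ in (0 : ℝ)..8, (SAlpha.energyDensity (3 / 2) (39 / 40) (Poly.eval UX) (Poly.eval UXd)) θ ≤ (-3 / 50 : ℝ) := by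
  have hseg := pw5b_seg0
  have hb := (hseg.bounds (by norm_num) (lo' := -1) (hi' := -3/50) (by norm_num) (by norm_num)).2
  have e0 : ((panelLeft (1/2 : ℚ) 0 : ℚ) : ℝ) = 0 := by norm_num [panelLeft]
  have e1 : ((panelLeft (1/8 : ℚ) 32 : ℚ) : ℝ) = 8 := by norm_num [panelLeft]
  have ei : ∀ t : ℝ, (TProg.toFunP (pw5bProg UX UXd) []) t * Poly.eval [1] t = (SAlpha.energyDensity (3 / 2) (39 / 40) (Poly.eval UX) (Poly.eval UXd)) t := by
    intro t
    rw [toFunP_pw5bProg]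
    simp [Poly.eval]
  rw [e0, e1] at hb
  simp only [ei] at hb
  norm_num at hb ⊢
  exact hb

/-- THE CERTIFIED ENERGY: `W[X; −8, 8] ≤ -3/25 < 0` (reflection `θ ↦ −θ` doubles the half-window integral). [instance data] -/
theorem energy_le : SAlpha.energy (3 / 2) (39 / 40) (Poly.eval UX) (Poly.eval UXd) (-8) 8 ≤ (-3 / 25 : ℝ) := by
  unfold SAlpha.energy
  have hint : ∀ a b : ℝ, IntervalIntegrable (SAlpha.energyDensity (3 / 2) (39 / 40) (Poly.eval UX) (Poly.eval UXd)) volume a b :=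
    fun a b => density_continuous.intervalIntegrable a b
  have hsplit := intervalIntegral.integral_add_adjacent_intervals (hint (-8) 0) (hint 0 8)
  have hrefl : ∫ θ in (-8 : ℝ)..0, (SAlpha.energyDensity (3 / 2) (39 / 40) (Poly.eval UX) (Poly.eval UXd)) θ = ∫ θ in (0 : ℝ)..8, (SAlpha.energyDensity (3 / 2) (39 / 40) (Poly.eval UX) (Poly.eval UXd)) θ := by
    have h1 := intervalIntegral.integral_comp_neg (a := (0 : ℝ)) (b := 8) (SAlpha.energyDensity (3 / 2) (39 / 40) (Poly.eval UX) (Poly.eval UXd))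
    simp only [neg_zero] at h1
    rw [← h1]
    exact intervalIntegral.integral_congr fun x _ => density_even x
  have hh := half_integral_le
  linarith

/-! ### §3 The witness -/

/-- **THE ROW: `(s, α) = (3/2, 39/40)` IS ON THE UNSTABLE SIDE OF THE `s–α` MODEL** — the explicit even polynomial `X = Poly.eval UX`
(degree 26, `X(±8) = 0`) is a compactly supported trial function on the window `[−8, 8]` with NEGATIVE one-surface energy
(`≤ -3/25` with `X(0) ≈ 1`), i.e. an `SAlpha.UnstableWitness 3/2 (39/40) (−8) 8`.  MODEL `s–α`; «unstable» in the model's own one-surface (Newcomb / trial-function)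
sense; nothing about a device. [instance data] -/
theorem unstableWitness_threeHalves_0975 : SAlpha.UnstableWitness (3 / 2) (39 / 40) (-8) 8 (Poly.eval UX) (Poly.eval UXd) := by
  refine ⟨by norm_num, fun θ _ => hasDerivAt_UX θ, UX_at_negL, UX_at_L, ?_⟩
  have h := energy_le
  linarith


/-! ### §4 The band at `s = 3/2` as ONE interval (convexity in `α`, lit-3's engine BY NAME) -/

/-- **THE UNSTABLE SET AT SHEAR `3/2` CONTAINS THE WHOLE INTERVAL `[19/20, 39/40]`**: the same trial function has negative one-surface
energy at `α = 19/20` (`SAlphaPolyWitnessS15A095.unstableWitness_threeHalves_095`) and at `α = 39/40` (`unstableWitness_threeHalves_0975`), and the energy of a fixed trial function is convex in `α`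
(`BallooningSAlphaWitnessInterval.unstableWitness_of_mem_Icc`).  MODEL statement; no device. [instance data] -/
theorem unstableWitness_threeHalves_Icc :
    ∀ α ∈ Icc (19 / 20 : ℝ) (39 / 40), SAlpha.UnstableWitness (3 / 2) α (-8) 8 (Poly.eval UX) (Poly.eval UXd) :=
  SAlpha.unstableWitness_of_mem_Icc SAlphaPolyWitnessS15A095.unstableWitness_threeHalves_095 unstableWitness_threeHalves_0975

end SAlphaPolyWitnessS15A0975

end Summit.Ventures.FusionMHD.Models
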